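import Mathlib
import HarnessLib
import Summits.ValiantsHypothesis.ValiantsHypothesis.Theorems.LacunarySymmetroidMatrixDescartesProductPlusOneWronskianBudget
import Summits.ValiantsHypothesis.ValiantsHypothesis.Theorems.LacunarySymmetroidMatrixDescartesProductPlusOneWronskianRung0
import Summits.ValiantsHypothesis.ValiantsHypothesis.Theorems.LacunarySymmetroidMatrixDescartesProductPlusOneEulerRolle

/-!
# ValiantsHypothesis / LacunarySymmetroid — crux `MatrixDescartes` (stmt-ValiantsHypothesis-18050, V1),
# LINE (A) «product_plus_one»: the ONE-SIGNED company at EVERY coupling, every format `(m, K)`, every support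

The c-free twin of the closed stub S3 (`PosCoeffRung`, ✓ `…ProductPlusOnePosCoeff`) in EULER currency and at EVERY coupled letter
`l₀` (the wired S4″/S5 sector rows of the line — coherent / lower-signed / upper-signed / tame — sit at the two EXTREME couplings only).
Setting: rows `f_j = Σ_l C a_{jl} X^{d_l}` on a common support `d : Fin K → ℕ` (no monotonicity or injectivity needed), product
`P = ∏_j f_j`, c-free Euler numerator `R_{l₀} = Σ_j (Σ_l C(a_{jl}(d_l − d_{l₀})) X^{d_l})·∏_{i≠j} f_i = X·P′ − C(m·d_{l₀})·P`
(✓ `eulerNumerator_eq_general`), log-Wronskian `W(P) = P·θ²P − (θP)²`.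

* `card_posRoots_prod_eq_zero_of_sameSign` — a ROW-WISE ONE-SIGNED company (`a_{jl}·a_{jl'} ≥ 0` for all `j, l, l'`; rows may have
  different signs, degenerate letters allowed) has `Z₊(P) = 0`: `P² = ∏_j f_j²` has non-negative coefficients (✓ `coeff_fewnomial_mul_self_nonneg`,
  ✓ `coeff_prod_nonneg`), hence no positive zero (✓ `countP_pos_roots_eq_zero_of_coeff_nonneg`), and `Z(P) ⊆ Z(P²)`.
* ★ `eulerNumerator_pos_roots_le_one_of_sameSign` — for such a company, at EVERY coupling `l₀ : Fin K`:
  `Z₊(R_{l₀}) ≤ 1`.  Proof: the one-polynomial budget ✓ `card_posRoots_eulerNumerator_le_wronskian_add` (N2: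
  `Z₊(R_{l₀}) ≤ Z₊(W(P)) + 2·Z₊(P) + 1`, every coupling) with RUNG 0 ✓ `card_posRoots_wronskian_prod_eq_zero_of_sameSign` (`Z₊(W(P)) = 0`)
  and the previous item (`Z₊(P) = 0`).  Located reading: a one-signed row is log-convex in `log x`, so the total Euler ratio `Σ_j θf_j/f_j`
  is non-decreasing and meets each of the `K` coupling levels `m·d_{l₀}` at most once.
* `eulerNumerator_pos_roots_le_one_of_nonneg` — the same under the global hypothesis `a_{jl} ≥ 0` (S3's currency).
* `class_pos_roots_le_two_of_sameSign` — MEMBER currency at every coupling: `Z₊(C c·X^{m·d_{l₀}} + P) ≤ 2` for every real `c`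
  (✓ `card_pos_roots_class_le_euler`); for `a_{jl} ≥ 0` this is ✓ `card_pos_roots_prod_sub_monomial_le_two` (Descartes on the member),
  here obtained for row-wise signs and through the Euler count.

HONEST FRAMING: a (small) every-coupling sector row of the research stubs `stub_eulerBoundK3` / `stub_polyLaw` in the currency of
`EulerBoundPoly`; closes NO stub by name; NOT `OneChangeFloorK3`, `ClassRowK3Linear`, `EulerBoundK3`, `PPOPolyLaw`, `ProductPlusOneMDR`,
`MatrixDescartes`; `VP ≠ VNP` is NOT proved and nothing here bears on it.  No definitions, no named facts, no sorry; Mathlib + the three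
✓ files imported.

[folklore] Descartes' rule of signs + the tree's crossing/interlacing frame; no citation needed.
-/

set_option linter.dupNamespace false

namespace Summit.ValiantsHypothesis.ValiantsHypothesis.Theorems.LacunarySymmetroidMatrixDescartes

namespace ProductPlusOne

open Polynomial Finset
open scoped BigOperators

/-- **A row-wise one-signed company has no positive zero**: if `a_{jl}·a_{jl'} ≥ 0` for all `j, l, l'` then
`Z₊(∏_j Σ_l C a_{jl} X^{d_l}) = 0` (every `m`, `K`, `d`). [folklore] -/
theorem card_posRoots_prod_eq_zero_of_sameSign {m K : ℕ} (d : Fin K → ℕ) (a : Fin m → Fin K → ℝ)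
    (hsame : ∀ j l l', 0 ≤ a j l * a j l') :
    ((∏ j, ∑ l, C (a j l) * X ^ (d l) : ℝ[X]).roots.toFinset.filter (fun t => 0 < t)).card = 0 := by
  classical
  set P : ℝ[X] := ∏ j, ∑ l, C (a j l) * X ^ (d l) with hP
  -- `P * P = ∏_j (f_j * f_j)` has non-negative coefficients
  have hsq : P * P = ∏ j, ((∑ l, C (a j l) * X ^ (d l) : ℝ[X]) * (∑ l, C (a j l) * X ^ (d l) : ℝ[X])) := by
    rw [hP, ← Finset.prod_mul_distrib]
  have hcoeff : ∀ i, 0 ≤ (P * P).coeff i := by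
    intro i
    rw [hsq]
    exact coeff_prod_nonneg _ _ (fun j _ n => coeff_fewnomial_mul_self_nonneg d (a j) (hsame j) n) i
  have hcount : (P * P).roots.countP (fun t => 0 < t) = 0 := countP_pos_roots_eq_zero_of_coeff_nonneg _ hcoeff
  rw [Finset.card_eq_zero, Finset.filter_eq_empty_iff]
  intro t ht ht0
  rw [Multiset.mem_toFinset] at ht
  have hP0 : P ≠ 0 := by
    intro h0
    rw [h0, roots_zero] at ht
    exact Multiset.notMem_zero t ht
  have hroot : IsRoot P t := (mem_roots hP0).1 ht
  have hPP0 : P * P ≠ 0 := mul_ne_zero hP0 hP0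
  have hmem : t ∈ (P * P).roots := by
    rw [mem_roots hPP0, IsRoot, eval_mul, hroot.eq_zero, zero_mul]
  have hpos : 0 < (P * P).roots.countP (fun t => 0 < t) :=
    Multiset.countP_pos.2 ⟨t, hmem, ht0⟩
  omega

/-- ★ **THE ONE-SIGNED COMPANY AT EVERY COUPLING** (every `m`, `K`, support `d`, coupled letter `l₀`): if `a_{jl}·a_{jl'} ≥ 0` for all
`j, l, l'` then the c-free Euler numerator `R_{l₀} = Σ_j (Σ_l C(a_{jl}(d_l − d_{l₀})) X^{d_l})·∏_{i≠j} f_i` has AT MOST ONE positive zero.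
[this file's theorem] -/
theorem eulerNumerator_pos_roots_le_one_of_sameSign {m K : ℕ} (d : Fin K → ℕ) (a : Fin m → Fin K → ℝ) (l₀ : Fin K)
    (hsame : ∀ j l l', 0 ≤ a j l * a j l') :
    ((∑ j, (∑ l, C (a j l * ((d l : ℝ) - d l₀)) * X ^ (d l)) * ∏ i ∈ Finset.univ.erase j, (∑ l, C (a i l) * X ^ (d l))
        : ℝ[X]).roots.toFinset.filter (fun t => 0 < t)).card ≤ 1 := by
  have h1 := card_posRoots_eulerNumerator_le_wronskian_add d a l₀
  have h2 := card_posRoots_wronskian_prod_eq_zero_of_sameSign d a hsame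
  have h3 := card_posRoots_prod_eq_zero_of_sameSign d a hsame
  omega

/-- The one-signed company at every coupling, in S3's currency `a_{jl} ≥ 0`: `Z₊(R_{l₀}) ≤ 1`. [this file's theorem] -/
theorem eulerNumerator_pos_roots_le_one_of_nonneg {m K : ℕ} (d : Fin K → ℕ) (a : Fin m → Fin K → ℝ) (l₀ : Fin K)
    (ha : ∀ j l, 0 ≤ a j l) :
    ((∑ j, (∑ l, C (a j l * ((d l : ℝ) - d l₀)) * X ^ (d l)) * ∏ i ∈ Finset.univ.erase j, (∑ l, C (a i l) * X ^ (d l))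
        : ℝ[X]).roots.toFinset.filter (fun t => 0 < t)).card ≤ 1 :=
  eulerNumerator_pos_roots_le_one_of_sameSign d a l₀ (fun j l l' => mul_nonneg (ha j l) (ha j l'))

/-- **MEMBER currency at every coupling**: for a row-wise one-signed company and every real `c`,
`Z₊(C c·X^{m·d_{l₀}} + ∏_j f_j) ≤ 2`. [this file's theorem] -/
theorem class_pos_roots_le_two_of_sameSign {m K : ℕ} (d : Fin K → ℕ) (a : Fin m → Fin K → ℝ) (l₀ : Fin K)
    (hsame : ∀ j l l', 0 ≤ a j l * a j l') (c : ℝ) :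
    ((C c * X ^ (m * d l₀) + ∏ j, ∑ l, C (a j l) * X ^ (d l) : ℝ[X]).roots.toFinset.filter (fun t => 0 < t)).card ≤ 2 := by
  have h1 := card_pos_roots_class_le_euler d a l₀ c
  have h2 := eulerNumerator_pos_roots_le_one_of_sameSign d a l₀ hsame
  omega

end ProductPlusOne

end Summit.ValiantsHypothesis.ValiantsHypothesis.Theorems.LacunarySymmetroidMatrixDescartes
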